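/-
Copyright: cell pub-balaban-gaps (YM BLITZ Y1, track G1), seat g1-p2 GEN 5 (unit `pub-balaban-gaps-g1-p2`).  Row (D4) NODE O,
OBJECT ∕ MECHANISM level: PRINT'S s-DECORATION — POWER-ONE in the distinct parameters met by a walk ([II] p. 3: *"for a random
walk ω localized in X₀ ∪ X₁ ∪ … ∪ Xₙ we take the {Δ₁,…,Δ_m} of all cubes from σ₀ which intersect this localization domain, and
we multiply the term … corresponding to ω by Π_{j=1}^m s(Δ_j)"*) — applied to ANY block walk expansion, with the (1.11) cost
`e^{κ₁m}` paid by a RATE SHIFT (the prior programme's `Beta/CovariantTowerRowData.rateShift κ₁ = κ₁·P∕M₀` mechanism, unit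
`b2b-balaban-beta-d4-p2`, and `UnitLatticeDecoratedRowData` of d4-p3: *"the partition scale absorbs the decoration"*) under a
TUBE letter `#dec(ω) ≤ P₀ + P₁·D_ω` (print: *"δ₀d(ω) ≥ δ₁mM"*, (1.11) p. 5).  Repairs RESIDUE (D4) row V54 at the level of the
walk objects: window `ε ↦ ε − κ₁P₁`, rate `ρ ↦ ρ − κ₁P₁`, constants `× e^{κ₁P₀}` — "δ₁M ≥ κ₁", M LINEAR in κ₁.
HONEST FRAMING: bookkeeping over a hypothesis shape; the tube letter for Bałaban's walks and his Δ^{(k)} are NOT constructed;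
(D4) NOT discharged (instance 0∕1); NOT BetaPertH, NOT continuum, NOT Clay.
-/
import Summits.QuantumFields.BalabanUV.Gaps.D4WalkBlock

/-!
# `Gaps.D4WalkBlockDecorate` — print's power-one s-decoration of a block walk expansion, paid by a rate shift under a tube
letter (cell pub-balaban-gaps, seat g1-p2 gen 5)

HONEST DEPENDENCY (cell pub-balaban, verbatim): continuum YM on T⁴ ⇐ BetaPertH ∧ nine spine estimates (0/9 proved);
BetaPertH ⇐ (D1) ∧ (D4) ∧ CAP+tail.

WHY.  The cell's block chain (`D4WalkBlockProduct ∕ Neumann ∕ Glue ∕ OneScale ∕ Parametrix`) multiplies DECORATED one-step terms,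
so a chain's s-monomial carries MULTIPLICITIES and every step pays `e^{κ₁m_J}` in the Neumann margin (regime token «M ≳ e^{O(κ₁)}»,
g1-plan-1 L-10 ∕ RESIDUE (D4) V54).  Print decorates a walk ONCE per distinct parameter ([II] p. 3) and pays `e^{κ₁m}` by the walk's
length ((1.11) p. 5: *"m is the number of the parameters s connected with the walk ω … δ₀d(ω) ≥ δ₁mM … for δ₁M ≥ κ₁"*).  THIS FILE:
given ANY block walk expansion (typically run with TAG decorations at polydisc radius `1`, i.e. consts with `κ₁ = 0`, so that its
amplitudes carry no `e^{κ₁m_J}`), a decoration map `dec : W → Finset (parameters)` whose non-empty values sit on σ-carrying terms, and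
the TUBE letter `#dec(ω) ≤ P₀ + P₁·D_ω(y,y′)` on the support of the term's blocks, the POWER-ONE decorated family
`ω ↦ (Π_{j ∈ dec ω} σ_j)·T_ω(1,u)` is a block walk expansion on the polydisc of radius `e^{κ₁}` with window `ε − κ₁P₁`, rate
`ρ − κ₁P₁`, constants `× e^{κ₁P₀}` (`blockWalkExpansion_decorate`); at `σ ≡ 1` its kernel is the original one (`kernel_decorate_one`).
* §1 summability from bounded partial sums; the decorated kernel as an entrywise `tsum`.
* §2 `blockWalkExpansion_decorate`, `kernel_decorate_one`.
WHAT IT IS NOT: the tube letter for the chains of `D4WalkBlockParametrix` (packing on the cube torus + `chainDist ≥` path length through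
the via-sets; the prior `UnitLatticeTubeCount.card_tubeDec_le` is the model) is NOT proved here; nothing of Bałaban's; (D4) 0∕1.
-/

noncomputable section

namespace Summit.QuantumFields.BalabanUV.Gaps.D4WalkBlockDecorate

open Metric Set Finset
open Literature.MathematicalPhysics.QuantumFieldTheory.Balaban1983to89
open Literature.MathematicalPhysics.QuantumFieldTheory.Balaban1983to89.B9SectDWalk (Through MajSumLe DomBy)
open Literature.MathematicalPhysics.QuantumFieldTheory.Balaban1983to89.B9Thm34Ext (toB6)
open Literature.MathematicalPhysics.QuantumFieldTheory.Balaban1983to89.B9Thm37GlueTorus (torusGeom tdist1 tdist1_nonneg)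
open Literature.MathematicalPhysics.QuantumFieldTheory.Balaban1983to89.TreeLengthTorus (TPt)
open Literature.MathematicalPhysics.QuantumFieldTheory.Balaban1983to89.B5TorusCover (UT)
open Summit.QuantumFields.BalabanUV.Gaps.D4WalkBlock
  (blockNorm blockNorm_nonneg blockNorm_smul_le norm_entry_le_blockNorm BlockWalkExpansion)

variable {d N' : ℕ} {ν : ℕ} {K : Fin ν → ℕ} [∀ i, NeZero (K i)]
variable {p n : Type} [Fintype p] [Fintype n]
variable {E : Type*} [NormedAddCommGroup E] [NormedSpace ℂ E]
variable {c₀ c : B13.Consts} {cub : p → UT K} {cubn : n → UT K} {K2 : (TPt d N' → ℂ) → E → Matrix p n ℂ}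
variable {X : Finset (UT K)} {R ε kap Kbar : ℝ}
variable {W : Type} {T2 : W → (TPt d N' → ℂ) → E → Matrix p n ℂ} {SX : Set W} {A : W → ℝ}
variable {D : W → UT K → UT K → ℝ} {ρ : ℝ}

/-! ## §1. Summability from the located majorant sums; the decorated kernel -/

/-- A non-negative real family with uniformly bounded finite partial sums is summable. [folklore] -/
theorem summable_of_partial_le {f : W → ℝ} (hf : ∀ w, 0 ≤ f w) {B : ℝ} (hB : ∀ S : Finset W, ∑ w ∈ S, f w ≤ B) :
    Summable f :=
  summable_of_sum_le hf hB

/-- **Entrywise summability of the terms of a block walk expansion** at any point of polydisc × ball (the majorants have bounded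
partial sums by `majSum`, `ε ≥ 0`). [cite: Balaban1985BackgroundPropagators, (3.107)–(3.108) p.416] -/
theorem summable_term_apply (h : BlockWalkExpansion c₀ cub cubn K2 X R ε kap Kbar T2 SX A D ρ) (hε : 0 ≤ ε)
    (σ : TPt d N' → ℂ) (hσ : ∀ j, ‖σ j‖ ≤ Real.exp c₀.κ₁) (u : E) (hu : u ∈ ball (0 : E) R) (i : p) (j : n) :
    Summable fun w => T2 w σ u i j := by
  refine Summable.of_norm_bounded (g := fun w => A w * Real.exp (-((ρ - ε) * D w (cub i) (cubn j)))) ?_ (fun w => ?_)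
  · refine summable_of_partial_le (fun w => mul_nonneg (h.A_nonneg w) (Real.exp_nonneg _)) (B := Kbar * Real.exp (-(kap * tdist1 K (cub i) (cubn j)))) fun S => h.majSum S (cub i) (cubn j)
  · refine (norm_entry_le_blockNorm cub cubn (T2 w σ u) i j).trans ((h.majB w σ hσ u hu (cub i) (cubn j)).trans ?_)
    refine mul_le_mul_of_nonneg_left (Real.exp_le_exp.2 ?_) (h.A_nonneg w)
    nlinarith [h.D_nonneg w (cub i) (cubn j)]

/-- The POWER-ONE decorated term `(Π_{j ∈ dec ω} σ_j)·T_ω(1,u)` ([II] p. 3). -/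
def decTerm (T2 : W → (TPt d N' → ℂ) → E → Matrix p n ℂ) (dec : W → Finset (TPt d N')) :
    W → (TPt d N' → ℂ) → E → Matrix p n ℂ :=
  fun w σ u => (∏ j ∈ dec w, σ j) • T2 w (fun _ => 1) u

/-- The decorated kernel, entrywise `Σ_ω` of the decorated terms ([II] p. 3: *"This way the s-dependent propagators … are defined.
They coincide with the original ones for s = 1"*). -/
def decKernel (T2 : W → (TPt d N' → ℂ) → E → Matrix p n ℂ) (dec : W → Finset (TPt d N')) :
    (TPt d N' → ℂ) → E → Matrix p n ℂ :=
  fun σ u => Matrix.of fun i j => ∑' w, decTerm T2 dec w σ u i j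

/-! ## §2. The power-one decoration is a block walk expansion at the shifted rate -/

/-- The s-monomial over `m` parameters on the polydisc of radius `e^{κ₁}` is bounded by `e^{κ₁m}` (`κ₁ ≥ 0`).
[cite: Balaban1988RG2Cluster, (1.11) p.5] -/
theorem norm_prod_le (J : Finset (TPt d N')) (σ : TPt d N' → ℂ) (hσ : ∀ j, ‖σ j‖ ≤ Real.exp c.κ₁) :
    ‖∏ j ∈ J, σ j‖ ≤ Real.exp (c.κ₁ * J.card) := by
  rw [norm_prod]
  calc ∏ j ∈ J, ‖σ j‖ ≤ ∏ _j ∈ J, Real.exp c.κ₁ := Finset.prod_le_prod (fun j _ => norm_nonneg _) fun j _ => hσ j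
    _ = Real.exp (c.κ₁ * J.card) := by rw [Finset.prod_const, ← Real.exp_nat_mul, mul_comm]

/-- **PRINT'S POWER-ONE DECORATION WITH RATE SHIFT.**  A block walk expansion at consts `c₀` (`κ₁(c₀) ≥ 0`, so `σ ≡ 1` lies in its
polydisc), a decoration map `dec` with `dec ω ≠ ∅ → ω ∈ SX`, and the TUBE letter on the support of each term's
blocks `#dec ω ≤ P₀ + P₁·D_ω(y,y′)`, with the shift fitting the window `κ₁P₁ ≤ ε` (print: `δ₁M ≥ κ₁`) ⟹ the decorated
family is a block walk expansion at consts `c` on the `R`-ball: window `ε − κ₁P₁`, torus rate `κ`, constant `e^{κ₁P₀}K̄`, amplitudes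
`e^{κ₁P₀}A_ω`, rate `ρ − κ₁P₁`, σ-carrying set `{ω ∣ dec ω ≠ ∅}`, the same walk distances.
[cite: Balaban1988RG2Cluster, p.3, (1.11) p.5, p.13, p.15; Balaban1985BackgroundPropagators, Thm 3.10 (3.107)–(3.108) p.416] -/
theorem blockWalkExpansion_decorate (h : BlockWalkExpansion c₀ cub cubn K2 X R ε kap Kbar T2 SX A D ρ) (hκ₁₀ : 0 ≤ c₀.κ₁)
    (hκ₁ : 0 ≤ c.κ₁) (dec : W → Finset (TPt d N')) (hdecSX : ∀ w, (dec w).Nonempty → w ∈ SX) {P₀ P₁ : ℝ}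
    (htube : ∀ w, ∀ u ∈ ball (0 : E) R, ∀ y y', blockNorm cub cubn (T2 w (fun _ => 1) u) y y' ≠ 0 →
      ((dec w).card : ℝ) ≤ P₀ + P₁ * D w y y')
    (hshift : c.κ₁ * P₁ ≤ ε) :
    BlockWalkExpansion c cub cubn (decKernel T2 dec) X R (ε - c.κ₁ * P₁) kap (Real.exp (c.κ₁ * P₀) * Kbar)
      (decTerm T2 dec) {w | (dec w).Nonempty} (fun w => Real.exp (c.κ₁ * P₀) * A w) D (ρ - c.κ₁ * P₁) := by
  have h1 : ∀ j : TPt d N', ‖(fun _ : TPt d N' => (1 : ℂ)) j‖ ≤ Real.exp c₀.κ₁ := fun _ => by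
    rw [norm_one]; exact Real.one_le_exp hκ₁₀
  -- the per-term block bound at the shifted rate
  have hmajB : ∀ w, ∀ σ : TPt d N' → ℂ, (∀ j, ‖σ j‖ ≤ Real.exp c.κ₁) → ∀ u ∈ ball (0 : E) R, ∀ y y',
      blockNorm cub cubn (decTerm T2 dec w σ u) y y' ≤
        (Real.exp (c.κ₁ * P₀) * A w) * Real.exp (-((ρ - c.κ₁ * P₁) * D w y y')) := by
    intro w σ hσ u hu y y'
    by_cases h0 : blockNorm cub cubn (T2 w (fun _ => 1) u) y y' = 0
    · calc blockNorm cub cubn (decTerm T2 dec w σ u) y y'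
          ≤ ‖∏ j ∈ dec w, σ j‖ * blockNorm cub cubn (T2 w (fun _ => 1) u) y y' := blockNorm_smul_le cub cubn _ _ y y'
        _ = 0 := by rw [h0, mul_zero]
        _ ≤ _ := mul_nonneg (mul_nonneg (Real.exp_nonneg _) (h.A_nonneg w)) (Real.exp_nonneg _)
    · have hcard := htube w u hu y y' h0
      have hm := norm_prod_le (c := c) (dec w) σ hσ
      calc blockNorm cub cubn (decTerm T2 dec w σ u) y y'
          ≤ ‖∏ j ∈ dec w, σ j‖ * blockNorm cub cubn (T2 w (fun _ => 1) u) y y' := blockNorm_smul_le cub cubn _ _ y y'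
        _ ≤ Real.exp (c.κ₁ * (dec w).card) * (A w * Real.exp (-(ρ * D w y y'))) :=
            mul_le_mul hm (h.majB w _ h1 u hu y y') (blockNorm_nonneg _ _ _ _ _) (Real.exp_nonneg _)
        _ ≤ Real.exp (c.κ₁ * (P₀ + P₁ * D w y y')) * (A w * Real.exp (-(ρ * D w y y'))) :=
            mul_le_mul_of_nonneg_right (Real.exp_le_exp.2 (mul_le_mul_of_nonneg_left hcard hκ₁))
              (mul_nonneg (h.A_nonneg w) (Real.exp_nonneg _))
        _ = (Real.exp (c.κ₁ * P₀) * A w) * Real.exp (-((ρ - c.κ₁ * P₁) * D w y y')) := by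
            rw [mul_add, Real.exp_add]
            have : Real.exp (c.κ₁ * (P₁ * D w y y')) * Real.exp (-(ρ * D w y y')) =
                Real.exp (-((ρ - c.κ₁ * P₁) * D w y y')) := by rw [← Real.exp_add]; ring_nf
            calc Real.exp (c.κ₁ * P₀) * Real.exp (c.κ₁ * (P₁ * D w y y')) * (A w * Real.exp (-(ρ * D w y y')))
                = Real.exp (c.κ₁ * P₀) * A w * (Real.exp (c.κ₁ * (P₁ * D w y y')) * Real.exp (-(ρ * D w y y'))) := by ring
              _ = _ := by rw [this]
  -- located partial sums at the window rate (ρ − κ₁P₁) − (ε − κ₁P₁) = ρ − ε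
  have hmajSum : MajSumLe (g := toB6 (torusGeom K 0 0 0) 0 True)
      (fun w a b => (Real.exp (c.κ₁ * P₀) * A w) * Real.exp (-((ρ - c.κ₁ * P₁ - (ε - c.κ₁ * P₁)) * D w a b)))
      (fun a b => (Real.exp (c.κ₁ * P₀) * Kbar) * Real.exp (-(kap * tdist1 K a b))) := by
    intro S a b
    have e : ρ - c.κ₁ * P₁ - (ε - c.κ₁ * P₁) = ρ - ε := by ring
    simp_rw [e]
    calc ∑ w ∈ S, Real.exp (c.κ₁ * P₀) * A w * Real.exp (-((ρ - ε) * D w a b))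
        = Real.exp (c.κ₁ * P₀) * ∑ w ∈ S, A w * Real.exp (-((ρ - ε) * D w a b)) := by
          rw [Finset.mul_sum]; exact Finset.sum_congr rfl fun w _ => by ring
      _ ≤ Real.exp (c.κ₁ * P₀) * (Kbar * Real.exp (-(kap * tdist1 K a b))) :=
          mul_le_mul_of_nonneg_left (h.majSum S a b) (Real.exp_nonneg _)
      _ = _ := by ring
  -- summability of the decorated terms (dominated by the tag-free terms times e^{κ₁ #dec})
  have hsum : ∀ σ : TPt d N' → ℂ, (∀ j, ‖σ j‖ ≤ Real.exp c.κ₁) → ∀ u ∈ ball (0 : E) R, ∀ i j,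
      Summable fun w => decTerm T2 dec w σ u i j := by
    intro σ hσ u hu i j
    have hwin : 0 ≤ ε - c.κ₁ * P₁ := by linarith
    refine Summable.of_norm_bounded
      (g := fun w => (Real.exp (c.κ₁ * P₀) * A w) * Real.exp (-((ρ - c.κ₁ * P₁ - (ε - c.κ₁ * P₁)) * D w (cub i) (cubn j)))) ?_
      (fun w => ?_)
    · exact summable_of_partial_le (fun w => mul_nonneg (mul_nonneg (Real.exp_nonneg _) (h.A_nonneg w)) (Real.exp_nonneg _))
        fun S => hmajSum S (cub i) (cubn j)
    · refine (norm_entry_le_blockNorm cub cubn _ i j).trans ((hmajB w σ hσ u hu (cub i) (cubn j)).trans ?_)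
      refine mul_le_mul_of_nonneg_left (Real.exp_le_exp.2 ?_) (mul_nonneg (Real.exp_nonneg _) (h.A_nonneg w))
      nlinarith [h.D_nonneg w (cub i) (cubn j)]
  exact
  { hasSum := fun σ hσ u hu i j => by
      rw [decKernel, Matrix.of_apply]
      exact (hsum σ hσ u hu i j).hasSum
    termAnalytic := fun w σ hσ i j => by
      simp only [decTerm, Matrix.smul_apply, smul_eq_mul]
      exact (differentiableOn_const _).mul (h.termAnalytic w _ h1 i j)
    majB := hmajB
    majSum := hmajSum
    indep := fun w hw σ hσ => by
      have he : dec w = ∅ := Finset.not_nonempty_iff_eq_empty.1 hw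
      simp only [decTerm, he, Finset.prod_empty]
    through := fun w hw => h.through w (hdecSX w hw)
    A_nonneg := fun w => mul_nonneg (Real.exp_nonneg _) (h.A_nonneg w)
    D_nonneg := h.D_nonneg }

/-- **At `σ ≡ 1` the decorated kernel IS the original kernel** ([II] p. 3: *"They coincide with the original ones for s = 1"*).
[cite: Balaban1988RG2Cluster, p.3] -/
theorem kernel_decorate_one (h : BlockWalkExpansion c₀ cub cubn K2 X R ε kap Kbar T2 SX A D ρ) (hκ₁₀ : 0 ≤ c₀.κ₁)
    (dec : W → Finset (TPt d N')) (u : E) (hu : u ∈ ball (0 : E) R) :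
    decKernel T2 dec (fun _ => 1) u = K2 (fun _ => 1) u := by
  have h1 : ∀ j : TPt d N', ‖(fun _ : TPt d N' => (1 : ℂ)) j‖ ≤ Real.exp c₀.κ₁ := fun _ => by
    rw [norm_one]; exact Real.one_le_exp hκ₁₀
  ext i j
  rw [decKernel, Matrix.of_apply]
  have e : (fun w => decTerm T2 dec w (fun _ => (1 : ℂ)) u i j) = fun w => T2 w (fun _ => 1) u i j := by
    funext w; simp [decTerm, Finset.prod_const_one]
  rw [e]
  exact (h.hasSum _ h1 u hu i j).tsum_eq

end Summit.QuantumFields.BalabanUV.Gaps.D4WalkBlockDecorate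

end
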